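import Summits.NavierStokesRegularity.NavierStokesRegularity.Theses.FilamentSkeletonRss
import HarnessLib.Audit

/-!
# Birth skeleton (BC3) of the crux `FilamentSkeletonRss.SkeletonEquilibrium`

(crux item `stmt-NavierStokesRegularity-15400`, rank 2, route `route-NavierStokesRegularity-FilamentSkeletonRss`;
tree path `Cruxes/SkeletonEquilibrium/Lines/birth.lean`; registrar `planner-skel-stmt-NavierStokesRegularity-15400-0`,
2026-08-17. The route predates the Lean birth certificate; this file supplies BC3 retroactively.)

THE CUT. `SkeletonEquilibrium` (N filaments in relative equilibrium of the regularised Biot–Savart law in the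
rotating Leray frame, with ONE supercritical stagnation point per filament, `w′(τ*) ≥ 3/2 + δ`, at arbitrarily
large circulation `Γ`) is cut along the seam the live line `Lines/Sketch.lean` executes — decidable algebra +
one analytic existence theorem + elementary perturbation — at the C₄ skew-quartet datum A1
(`N = 4`, `γ ≡ 16π`, `α = −1`, waist datum `P₀ = (1,0,−10)`, `e₀ = (0,4/5,3/5)`):

* `stub_equilibriumFamilyA1` [XL, OPEN — the analytic core; its twin in the live line is the theorem
  `Sketch.transfer_A1`, proved there from the ONE open registered stub `stub_coreSymmA2` plus landed bookkeeping
  (`stub_growthBookkeeping` p136450, `stub_transportC4Alpha` p134355, `stub_unitsAssemblyAlpha` p134359)]: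
  for every tolerance `ε > 0` there are `ρ > 0`, `K` such that at arbitrarily large `Γ` an EXACT relative
  equilibrium of four filaments exists with every curve clause of the crux (C², unit speed, injective, proper at
  both ends, curvature `≤ K/√Γ`, pairwise `ρ√Γ`-separated, Rosenhead kernel integrable, the tangency equation with
  circulations `Γ·16π` and `α = −1`) whose slips, after the parabolic rescaling `t = τ/√Γ`, `w ↦ w/√Γ`, are
  `ε`-close in `C¹` on the box `|t| ≤ 10` to the ONE `Γ`-independent rational model
  `W(t) = t/2 − 11/5 + 2400/(272t² − 320t + 425) + 2400/(144t² + 625) + 2400/(272t² + 320t + 425)`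
  (drift + the three Lorentzians of the image lines; `Wd` = its derivative, written out) and do not vanish for
  `|t| ≥ 10`. Why it might fail: the rescaled ends must be proper log-spiral solutions of the rotating binormal
  flow matched to the straight waist across the scale `√(log Γ)`; the linearised tangency map carries the exact
  Kelvin-wave multiplier and may not be invertible with bounds beating the matching defect (strategist census,
  `STRATEGY-CENSUS.md` §Decomposition; negation line `Lines/kelvin_sonic_negation.lean`).
* `stub_innerCertificateA1` [M, decidable rational algebra; LANDED twin (same name, same statement):
  `Summit.NavierStokesRegularity.NavierStokesRegularity.Theorems.SkeletonEquilibrium.Sketch.stub_innerCertificateA1`,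
  p134392]: the model has a certified window — `W(−31/10) ≤ −7/10`, `W(−12/5) ≥ 7/10`, `Wd ≥ 2` on
  `[−31/10, −12/5]`, `|W| ≥ 7/10` on `[−10, 10]` off the window.
* `stub_persistence` [S, real analysis; LANDED twin (same name, same statement):
  `Summit.NavierStokesRegularity.NavierStokesRegularity.Theorems.SkeletonEquilibrium.Sketch.stub_persistence`,
  p129612]: a `C¹`-`ε`-perturbation of a certified model on the box, non-vanishing off the box, has exactly one
  zero, with slope `≥ s − ε` there.

`SkeletonEquilibrium_of : SkeletonEquilibrium` (the ONLY theorem of this file concluding the crux; A12 layer invariant: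
conclusion = the crux BY NAME, no `Prop` hypotheses, placeholders only inside the three declared stubs, which it uses by
name) is the REAL composition (≈ 50 lines of glue): instantiate the model, take `ε = 1/4`, get the family, rescale each slip
`f(t) = w_j(√Γ t)/√Γ` (`f′(t) = w_j′(√Γ t)`), run persistence with window `[−31/10, −12/5]`, box `10`, margin `7/10`,
slope `2`, and transport the unique zero and the slope `2 − 1/4 ≥ 3/2 + 1/4` back to `τ = √Γ t`: the crux holds with
`N = 4`, `γ ≡ 16π`, `α = −1`, `δ = 1/4`. Its CLOSED twin `SkeletonEquilibrium_of_hyps : <sig familyA1> → <sig certificate>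
→ <sig persistence> → SkeletonEquilibrium` (same proof, the stub statements as hypotheses; axioms propext /
Classical.choice / Quot.sound, no placeholder anywhere) is the registrar's evidence file
`bc/SkeletonEquilibrium_birth_closed.lean` (attached to the crux item).

BC3 PROBES (folder `bc/probe_*.lean`, `lean check`): for each stub `S`, `S → SkeletonEquilibrium`,
`S → NavierStokesRegularity` and `S → ¬NavierStokesRegularity` by `first | exact? | simpa | aesop` all FAIL
(results quoted in `Lines/birth.md` / NOTES.md): no stub is cheaply the crux or the summit. The two landed
stubs are kept as registered stubs ON PURPOSE: they are the two other load-bearing pieces of the cut (the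
certificate is the route's advertised decidable first step), their statements are repeated verbatim so the
landed theorems discharge them by `exact`, and the placeholder count equals the stub count (3), none elsewhere.

Disproof used (`Cruxes/SkeletonEquilibrium/Disproof.lean`, cdisprove c1): (SC) ⟺ axial induced strain ≥ 1 + δ at
`τ*`; the rigid classes (axis, vertical arrays, straight lines, planar curves) all have slope `1/2` — honoured:
supercriticality here is the MUTUAL strain of the three image lines at the waist, certified exactly
(`stub_innerCertificateA1`, slope ≥ 2 = 1/2 + 3/2), and no stub is an instance of a landed `Negative/` lemma
(`StraightLinesVertical`, `PlanarSubcritical`, `StrainIdentity` refute only straight/planar/zero-strain witnesses).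
-/

noncomputable section

open Set MeasureTheory Filter Topology
open Literature.Analysis.FluidPDE

namespace Summit.NavierStokesRegularity.NavierStokesRegularity.Cruxes.SkeletonEquilibrium.Birth

set_option linter.unusedVariables false
set_option linter.dupNamespace false

/-- **stub 1 — `stub_equilibriumFamilyA1` (XL, OPEN; the analytic core of the crux in its own units).**
At the C₄ skew-quartet datum A1 (`N = 4`, `γ ≡ 16π`, `α = −1`): for every `ε > 0` there are `ρ > 0`, `K` such
that at arbitrarily large `Γ` an exact relative equilibrium `(Ξ, w)` exists with every curve clause of the crux
and slips whose parabolic rescalings `t ↦ w_j(√Γ t)/√Γ` are `ε`-close in `C¹` to the model `W` on `|t| ≤ 10`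
and non-vanishing for `|t| ≥ 10`. Twin in the live line: `Sketch.transfer_A1` ⇐ `stub_coreSymmA2` (open) +
landed bookkeeping. -/
theorem stub_equilibriumFamilyA1 :
    ∀ (W Wd : ℝ → ℝ),
      (∀ t, W t = t / 2 - 11 / 5 + 2400 / (272 * t ^ 2 - 320 * t + 425) + 2400 / (144 * t ^ 2 + 625)
                        + 2400 / (272 * t ^ 2 + 320 * t + 425)) →
      (∀ t, Wd t = 1 / 2 - 2400 * (544 * t - 320) / (272 * t ^ 2 - 320 * t + 425) ^ 2
                        - 2400 * (288 * t) / (144 * t ^ 2 + 625) ^ 2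
                        - 2400 * (544 * t + 320) / (272 * t ^ 2 + 320 * t + 425) ^ 2) →
      ∀ ε : ℝ, 0 < ε → ∃ ρ K : ℝ, 0 < ρ ∧ ∀ Γ₀ : ℝ, ∃ Γ : ℝ, Γ₀ ≤ Γ ∧ 0 < Γ ∧
        ∃ (Ξ : Fin 4 → ℝ → EuclideanSpace ℝ (Fin 3)) (w : Fin 4 → ℝ → ℝ),
          (∀ j, ContDiff ℝ 2 (Ξ j) ∧ Function.Injective (Ξ j) ∧ Differentiable ℝ (w j) ∧
              (∀ τ, ‖deriv (Ξ j) τ‖ = 1) ∧ (∀ τ, ‖iteratedDeriv 2 (Ξ j) τ‖ * Real.sqrt Γ ≤ K) ∧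
              Tendsto (fun τ => ‖Ξ j τ‖) atTop atTop ∧ Tendsto (fun τ => ‖Ξ j τ‖) atBot atTop) ∧
          (∀ j k, j ≠ k → ∀ τ σ, ρ * Real.sqrt Γ ≤ ‖Ξ j τ - Ξ k σ‖) ∧
          (∀ j (x : EuclideanSpace ℝ (Fin 3)), Integrable (fun σ : ℝ =>
              ((‖x - Ξ j σ‖ ^ 2 + 1) ^ (3 / 2 : ℝ))⁻¹ • cross (deriv (Ξ j) σ) (x - Ξ j σ))) ∧
          (∀ j τ, (∑ k : Fin 4, (Γ * (16 * Real.pi) / (4 * Real.pi)) • ∫ σ : ℝ,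
                ((‖Ξ j τ - Ξ k σ‖ ^ 2 + 1) ^ (3 / 2 : ℝ))⁻¹ • cross (deriv (Ξ k) σ) (Ξ j τ - Ξ k σ))
              + (1 / 2 : ℝ) • Ξ j τ - (-1 : ℝ) • cross (EuclideanSpace.single (2 : Fin 3) (1 : ℝ)) (Ξ j τ)
              = w j τ • deriv (Ξ j) τ) ∧
          (∀ j t, |t| ≤ 10 →
              |w j (Real.sqrt Γ * t) / Real.sqrt Γ - W t| ≤ ε ∧ |deriv (w j) (Real.sqrt Γ * t) - Wd t| ≤ ε) ∧
          (∀ j t, 10 ≤ |t| → w j (Real.sqrt Γ * t) ≠ 0) := by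
  sorry

/-- **stub 2 — `stub_innerCertificateA1` (M, decidable; LANDED twin p134392, same name and statement under
`…Theorems.SkeletonEquilibrium.Sketch`).** The window certificate of the model slip. -/
theorem stub_innerCertificateA1 :
    ∀ (W Wd : ℝ → ℝ),
      (∀ t, W t = t / 2 - 11 / 5 + 2400 / (272 * t ^ 2 - 320 * t + 425) + 2400 / (144 * t ^ 2 + 625)
                        + 2400 / (272 * t ^ 2 + 320 * t + 425)) →
      (∀ t, Wd t = 1 / 2 - 2400 * (544 * t - 320) / (272 * t ^ 2 - 320 * t + 425) ^ 2
                        - 2400 * (288 * t) / (144 * t ^ 2 + 625) ^ 2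
                        - 2400 * (544 * t + 320) / (272 * t ^ 2 + 320 * t + 425) ^ 2) →
      W (-31 / 10) ≤ -(7 / 10) ∧ 7 / 10 ≤ W (-12 / 5) ∧
      (∀ t, -31 / 10 ≤ t → t ≤ -12 / 5 → 2 ≤ Wd t) ∧
      (∀ t, -10 ≤ t → t ≤ 10 → (t ≤ -31 / 10 ∨ -12 / 5 ≤ t) → 7 / 10 ≤ |W t|) := by
  sorry

/-- **stub 3 — `stub_persistence` (S; LANDED twin p129612, same name and statement under
`…Theorems.SkeletonEquilibrium.Sketch`).** Persistence of a certified transversal zero under a `C¹`-small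
perturbation on a box, with non-vanishing off the box. -/
theorem stub_persistence :
    ∀ (f W Wd : ℝ → ℝ) (a b T m s ε : ℝ), Differentiable ℝ f → -T ≤ a → a < b → b ≤ T →
      0 ≤ ε → ε < m → ε < s →
      W a ≤ -m → m ≤ W b → (∀ t, a ≤ t → t ≤ b → s ≤ Wd t) →
      (∀ t, -T ≤ t → t ≤ T → (t ≤ a ∨ b ≤ t) → m ≤ |W t|) →
      (∀ t, |t| ≤ T → |f t - W t| ≤ ε ∧ |deriv f t - Wd t| ≤ ε) →
      (∀ t, T ≤ |t| → f t ≠ 0) →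
      ∃ ts, f ts = 0 ∧ (∀ t, f t = 0 → t = ts) ∧ s - ε ≤ deriv f ts := by
  sorry


/-- Rescaling a slip: `t ↦ w (c t) / c` has derivative `w′ (c t)`. -/
theorem deriv_rescale (w : ℝ → ℝ) (c : ℝ) (hc : c ≠ 0) (t : ℝ) :
    deriv (fun s => w (c * s) / c) t = deriv w (c * t) := by
  rw [deriv_div_const, deriv_comp_mul_left c w t, smul_eq_mul]
  field_simp

/-- **Birth composition (the skeleton theorem).** The crux BY NAME from the three registered stubs, used by name
(`N = 4`, `γ ≡ 16π`, `α = −1`, `δ = 1/4`, `ε = 1/4`); ≈ 50 lines of real glue (rescaling, persistence, transport of the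
zero and the slope). The same proof with the stub STATEMENTS as hypotheses — a closed theorem, axioms
`propext / Classical.choice / Quot.sound` — is the registrar's evidence file `bc/SkeletonEquilibrium_birth_closed.lean`. -/
theorem SkeletonEquilibrium_of : Theses.FilamentSkeletonRss.SkeletonEquilibrium := by
  have hfamily := stub_equilibriumFamilyA1
  have hcert := stub_innerCertificateA1
  have hpersist := stub_persistence
  -- the model slip and its derivative, pinned by their defining equations
  let W : ℝ → ℝ := fun t => t / 2 - 11 / 5 + 2400 / (272 * t ^ 2 - 320 * t + 425)
    + 2400 / (144 * t ^ 2 + 625) + 2400 / (272 * t ^ 2 + 320 * t + 425)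
  let Wd : ℝ → ℝ := fun t => 1 / 2 - 2400 * (544 * t - 320) / (272 * t ^ 2 - 320 * t + 425) ^ 2
    - 2400 * (288 * t) / (144 * t ^ 2 + 625) ^ 2
    - 2400 * (544 * t + 320) / (272 * t ^ 2 + 320 * t + 425) ^ 2
  have hW : ∀ t, W t = t / 2 - 11 / 5 + 2400 / (272 * t ^ 2 - 320 * t + 425) + 2400 / (144 * t ^ 2 + 625)
      + 2400 / (272 * t ^ 2 + 320 * t + 425) := fun t => rfl
  have hWd : ∀ t, Wd t = 1 / 2 - 2400 * (544 * t - 320) / (272 * t ^ 2 - 320 * t + 425) ^ 2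
      - 2400 * (288 * t) / (144 * t ^ 2 + 625) ^ 2
      - 2400 * (544 * t + 320) / (272 * t ^ 2 + 320 * t + 425) ^ 2 := fun t => rfl
  -- the certificate and the family at tolerance ε = 1/4
  obtain ⟨hC1, hC2, hC3, hC4⟩ := hcert W Wd hW hWd
  obtain ⟨ρ, K, hρ, hmain⟩ := hfamily W Wd hW hWd (1 / 4) (by norm_num)
  refine ⟨4, fun _ => 16 * Real.pi, -1, 1 / 4, ρ, K, by norm_num, by norm_num, by norm_num, hρ,
    fun _ => mul_ne_zero (by norm_num) Real.pi_ne_zero, ?_⟩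
  intro Γ₀
  obtain ⟨Γ, hΓ₀, hΓ, Ξ, w, ha, hb, hc, hd, he, hfar⟩ := hmain Γ₀
  refine ⟨Γ, hΓ₀, hΓ, Ξ, w, ha, hb, hc, hd, ?_⟩
  intro j
  have hsq : Real.sqrt Γ ≠ 0 := (Real.sqrt_pos.2 hΓ).ne'
  -- the rescaled slip of filament j
  set f : ℝ → ℝ := fun t => w j (Real.sqrt Γ * t) / Real.sqrt Γ with hf_def
  have hwdiff : Differentiable ℝ (w j) := (ha j).2.2.1
  have hfd : Differentiable ℝ f :=
    (hwdiff.comp (differentiable_id.const_mul (Real.sqrt Γ))).div_const _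
  have hfderiv : ∀ t, deriv f t = deriv (w j) (Real.sqrt Γ * t) := fun t =>
    deriv_rescale (w j) (Real.sqrt Γ) hsq t
  have hclose : ∀ t, |t| ≤ 10 → |f t - W t| ≤ 1 / 4 ∧ |deriv f t - Wd t| ≤ 1 / 4 := by
    intro t ht
    obtain ⟨h1, h2⟩ := he j t ht
    exact ⟨h1, by rw [hfderiv]; exact h2⟩
  have hfarf : ∀ t, 10 ≤ |t| → f t ≠ 0 := by
    intro t ht hft
    exact hfar j t ht ((div_eq_zero_iff.1 hft).resolve_right hsq)
  -- persistence: window [−31/10, −12/5], box 10, margin 7/10, slope 2, tolerance 1/4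
  obtain ⟨ts, h0, huniq, hslope⟩ :=
    hpersist f W Wd (-31 / 10) (-12 / 5) 10 (7 / 10) 2 (1 / 4) hfd (by norm_num) (by norm_num) (by norm_num)
      (by norm_num) (by norm_num) (by norm_num) hC1 hC2 hC3 hC4 hclose hfarf
  refine ⟨Real.sqrt Γ * ts, ?_, ?_, ?_⟩
  · -- the zero, transported back to τ = √Γ t
    have : f ts = 0 := h0
    exact (div_eq_zero_iff.1 this).resolve_right hsq
  · -- uniqueness
    intro τ hτ
    have hft : f (τ / Real.sqrt Γ) = 0 := by
      simp only [hf_def, mul_div_cancel₀ τ hsq, hτ, zero_div]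
    have := huniq _ hft
    rw [← this, mul_div_cancel₀ τ hsq]
  · -- the slope: w_j′(√Γ ts) = f′(ts) ≥ 2 − 1/4 = 3/2 + 1/4
    have := hfderiv ts
    rw [← this]
    linarith

end Summit.NavierStokesRegularity.NavierStokesRegularity.Cruxes.SkeletonEquilibrium.Birth
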